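import Literature.NumberTheory.Transcendental.ManyCurveClosing
import HarnessLib

/-!
# Crux `RealOnePeriodRelations` (stmt-KontsevichZagierPeriods-10042),
# line `nash-retraction-thin-strip`, stub `stub_famDichotomyOfEngine`:
# the first-run dichotomy of Baker's method on a family standard model from an engine output

The FIRST-RUN DICHOTOMY of Baker's method (Baker–Wüstholz 2007, Thm. 6.15, §6.8) on a family
standard model `M = 𝔾ₘ^β × P` (lattice family `L : J → PeriodPair`, class map `cls : γ → J`,
extension data `κ`; `ManyCurveStd.lean`, …, `ManyCurveClosing.lean`), with the output of the
ENGINE (the auxiliary form `P` of degree `D`, not vanishing identically on `M`, vanishing to high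
order along `𝔟` at the multiples `s·w`, `0 ≤ s ≤ nS`, with the zero-estimate numerics) supplied as
the hypothesis `heng` instead of being computed from a Baker datum — so that it applies at GENERAL
algebraic points once the general-point engine is available. It is the lattice-family twin of the
one-lattice `GaGmE.Std.dichotomy_of_engine` (`SemistabilityStdOfEngine.lean`), and the proof is the
closing logic of `GaGmEFam.Std.dichotomy` (`ManyCurveClosing.lean`) verbatim: the degenerate case
`𝔟 = 0` (`K = 0`), Philippon's zero estimate `hphil` (Philippon 1986, Thm. 2.1, stated inline for
the family theta model exactly as in `GaGmEFam.Std.dichotomy`), the obstruction subgroup `K ≠ M`,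
index descent `Semistable.index_le`, and the orbit dichotomy (`orbitCard_lt_imp`).

References: A. Baker, G. Wüstholz, *Logarithmic Forms and Diophantine Geometry*, New Math.
Monogr. 9, CUP 2007, Thm. 6.15, §6.7, §6.8 (pp. 115–119). [BakerWustholz2007]
P. Philippon, *Lemmes de zéros dans les groupes algébriques commutatifs*, Bull. SMF 114 (1986),
Thm. 2.1. [Philippon1986]
-/

noncomputable section

open Complex Module Submodule
open Literature.NumberTheory.Transcendental

namespace Summit.KontsevichZagierPeriods.SymplecticScissors.RealOnePeriodRelations.MultiEllLayer

/-- **The dichotomy of Baker's method on a family standard model `M` from an engine output.**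
Let `𝔟 ⊊ Lie M` be `ℚ̄`-rational and semistable, `w ∈ 𝔟`. Suppose that (when `𝔟 ≠ 0`) for every
`c > 0` there are `D, S ≥ 1`, `T` and a form `P` of degree `D` with `F_P ≢ 0` on `M`, vanishing to
order `≥ nT + 1` along `𝔟` at `s·w` for `0 ≤ s ≤ nS`, such that for all `m < n` and `e` with
`dim 𝔟·(n - m) ≤ e·n`: `c·D^n < binom(T+e, e)·(S+1)·D^m`, and `c·D^n < binom(T+e, e)·D^m` when
the index inequality is strict. Then, granted Philippon's zero estimate for `M` (the hypothesis
`hphil`), there is a connected algebraic subgroup datum `K ≠ M` over `ℂ`, BORDERLINE for the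
semistability of `𝔟`, with a multiple `r·w` (`r ≥ 1`) in `Lie K_ℂ + ker(exp)`.
[cite: BakerWustholz2007, §6.8 (p. 119)] [cite: Philippon1986, Thm 2.1] -/
theorem stub_famDichotomyOfEngine {J : Type} [Fintype J] [DecidableEq J] (L : J → PeriodPair)
    {β γ δ : Type} [Fintype β] [Fintype γ] [Fintype δ] [DecidableEq β] [DecidableEq γ] [DecidableEq δ]
    (cls : γ → J) (κM : δ → γ → GaGmE.Kbar)
    (hphil : ∃ c : ℝ, 0 < c ∧ ∀ (𝔟 : Submodule ℂ (β ⊕ (γ ⊕ δ) → ℂ)) (v : β ⊕ (γ ⊕ δ) → ℂ)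
      (P : MvPolynomial (Option β × GaGmE.Std.ThetaIdx γ δ) ℂ) (D S T : ℕ),
      0 < Module.finrank ℂ 𝔟 → 1 ≤ D → 1 ≤ S → P.IsHomogeneous D → (∃ w, GaGmEFam.Std.thetaEval L cls κM P w ≠ 0) →
      (∀ s : ℕ, s ≤ Fintype.card (β ⊕ (γ ⊕ δ)) * S →
        GaGmE.Std.VanishesAlong 𝔟 (GaGmEFam.Std.thetaEval L cls κM P) ((s : ℂ) • v) (Fintype.card (β ⊕ (γ ⊕ δ)) * T + 1)) →
      ∃ K : GaGmEFam.Std.SubgroupDataC β γ δ cls κM, (∃ w₀, ∀ w ∈ K.tangent, GaGmEFam.Std.thetaEval L cls κM P (w₀ + w) = 0) ∧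
        (Nat.choose (T + (Module.finrank ℂ 𝔟 - Module.finrank ℂ ↥(𝔟 ⊓ K.tangent)))
            (Module.finrank ℂ 𝔟 - Module.finrank ℂ ↥(𝔟 ⊓ K.tangent)) : ℝ) *
          (GaGmEFam.Std.orbitCard L cls κM K v S : ℝ) * (D : ℝ) ^ Module.finrank ℂ K.tangent ≤
          c * (D : ℝ) ^ Fintype.card (β ⊕ (γ ⊕ δ)))
    {𝔟 : Submodule ℂ (β ⊕ (γ ⊕ δ) → ℂ)} (hrat : LiePresentation.IsKRational GaGmE.Kbar 𝔟) (h𝔟 : 𝔟 ≠ ⊤)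
    (hss : GaGmEFam.Std.Semistable cls κM 𝔟) {w : β ⊕ (γ ⊕ δ) → ℂ} (hw𝔟 : w ∈ 𝔟)
    (heng : 0 < Module.finrank ℂ 𝔟 → ∀ c : ℝ, 0 < c →
      ∃ (D S T : ℕ) (P : MvPolynomial (Option β × GaGmE.Std.ThetaIdx γ δ) ℂ), 1 ≤ D ∧ 1 ≤ S ∧
        P.IsHomogeneous D ∧ (∃ w', GaGmEFam.Std.thetaEval L cls κM P w' ≠ 0) ∧
        (∀ s : ℕ, s ≤ Fintype.card (β ⊕ (γ ⊕ δ)) * S →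
          GaGmE.Std.VanishesAlong 𝔟 (GaGmEFam.Std.thetaEval L cls κM P) ((s : ℂ) • w) (Fintype.card (β ⊕ (γ ⊕ δ)) * T + 1)) ∧
        ∀ e m : ℕ, m < Fintype.card (β ⊕ (γ ⊕ δ)) →
          Module.finrank ℂ 𝔟 * (Fintype.card (β ⊕ (γ ⊕ δ)) - m) ≤ e * Fintype.card (β ⊕ (γ ⊕ δ)) →
          c * (D : ℝ) ^ Fintype.card (β ⊕ (γ ⊕ δ)) < (Nat.choose (T + e) e : ℝ) * ((S : ℝ) + 1) * (D : ℝ) ^ m ∧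
          (Module.finrank ℂ 𝔟 * (Fintype.card (β ⊕ (γ ⊕ δ)) - m) < e * Fintype.card (β ⊕ (γ ⊕ δ)) →
            c * (D : ℝ) ^ Fintype.card (β ⊕ (γ ⊕ δ)) < (Nat.choose (T + e) e : ℝ) * (D : ℝ) ^ m)) :
    ∃ K : GaGmEFam.Std.SubgroupDataC β γ δ cls κM, K.tangent ≠ ⊤ ∧
      Module.finrank ℂ 𝔟 * (Fintype.card (β ⊕ (γ ⊕ δ)) - Module.finrank ℂ K.tangent) =
        (Module.finrank ℂ 𝔟 - Module.finrank ℂ ↥(𝔟 ⊓ K.tangent)) * Fintype.card (β ⊕ (γ ⊕ δ)) ∧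
      ∃ r : ℕ, 0 < r ∧ (r : ℂ) • w ∈ GaGmEFam.Std.preimageSubgroup L cls κM K := by
  classical
  set n := Fintype.card (β ⊕ (γ ⊕ δ)) with hn
  -- `dim 𝔟 < n`
  have h𝔟lt : Module.finrank ℂ 𝔟 < n := by
    have := Submodule.finrank_lt h𝔟; simpa [hn] using this
  -- the degenerate case `𝔟 = 0`: `w = 0`, take `K = 0`
  by_cases h0 : Module.finrank ℂ 𝔟 = 0
  · have h𝔟0 : 𝔟 = ⊥ := Submodule.finrank_eq_zero.mp h0
    have hw0 : w = 0 := by rw [h𝔟0, Submodule.mem_bot] at hw𝔟; exact hw𝔟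
    refine ⟨GaGmEFam.Std.SubgroupDataC.zero cls κM, ?_, ?_, 1, one_pos, ?_⟩
    · rw [GaGmEFam.Std.SubgroupDataC.tangent_zero]
      intro h
      have : Module.finrank ℂ (⊥ : Submodule ℂ (β ⊕ (γ ⊕ δ) → ℂ)) =
          Module.finrank ℂ (⊤ : Submodule ℂ (β ⊕ (γ ⊕ δ) → ℂ)) := by rw [h]
      rw [finrank_bot, finrank_top, Module.finrank_fintype_fun_eq_card, ← hn] at this
      omega
    · rw [h0]; simp
    · rw [hw0, smul_zero]; exact AddSubgroup.zero_mem _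
  have h𝔟pos : 0 < Module.finrank ℂ 𝔟 := Nat.pos_of_ne_zero h0
  -- Philippon's constant and the engine output beating it
  obtain ⟨c, hc, hZ⟩ := hphil
  obtain ⟨D, S, T, P, hD1, hS, hP, hne, hvan, hineq⟩ := heng h𝔟pos c hc
  -- Philippon's zero estimate
  obtain ⟨K, ⟨w₀, hw₀⟩, hK⟩ := hZ 𝔟 w P D S T h𝔟pos hD1 hS hP hne hvan
  -- `K ≠ M`
  have hKtop : K.tangent ≠ ⊤ := by
    intro htop
    obtain ⟨w', hw'⟩ := hne
    apply hw'
    have := hw₀ (w' - w₀) (by rw [htop]; trivial)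
    simpa using this
  have hm : Module.finrank ℂ K.tangent < n := by
    have := Submodule.finrank_lt hKtop; simpa [hn] using this
  -- the index inequality
  have hidx := hss.index_le cls κM hrat K hKtop
  set e := Module.finrank ℂ 𝔟 - Module.finrank ℂ ↥(𝔟 ⊓ K.tangent)
  set m := Module.finrank ℂ K.tangent
  obtain ⟨hfull, hstrict⟩ := hineq e m hm hidx
  -- orbit dichotomy
  have horb_le := GaGmEFam.Std.orbitCard_le L cls κM K w S
  have hD0 : (0 : ℝ) < (D : ℝ) := by exact_mod_cast hD1
  by_cases horb : GaGmEFam.Std.orbitCard L cls κM K w S = S + 1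
  · -- full orbit: numerics contradict Philippon
    exfalso
    rw [horb] at hK
    push_cast at hK hfull
    linarith
  · -- small orbit: a multiple of `w` meets `Lie K + ker`; then `K` must be borderline
    obtain ⟨r, hr, -, hrmem⟩ :=
      GaGmEFam.Std.orbitCard_lt_imp L cls κM K w S (lt_of_le_of_ne horb_le horb)
    refine ⟨K, hKtop, ?_, r, hr, hrmem⟩
    by_contra hneq
    have hlt : Module.finrank ℂ 𝔟 * (n - m) < e * n := lt_of_le_of_ne hidx hneq
    have h1 := hstrict hlt
    have horb1 : (1 : ℝ) ≤ GaGmEFam.Std.orbitCard L cls κM K w S := by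
      exact_mod_cast GaGmEFam.Std.one_le_orbitCard L cls κM K w S
    have h2 : (Nat.choose (T + e) e : ℝ) * (D : ℝ) ^ m ≤
        (Nat.choose (T + e) e : ℝ) * (GaGmEFam.Std.orbitCard L cls κM K w S : ℝ) * (D : ℝ) ^ m := by
      have hch : (0 : ℝ) ≤ (Nat.choose (T + e) e : ℝ) := Nat.cast_nonneg _
      have hpow : (0 : ℝ) ≤ (D : ℝ) ^ m := by positivity
      rw [show (Nat.choose (T + e) e : ℝ) * (D : ℝ) ^ m =
        (Nat.choose (T + e) e : ℝ) * 1 * (D : ℝ) ^ m from by ring]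
      exact mul_le_mul_of_nonneg_right (mul_le_mul_of_nonneg_left horb1 hch) hpow
    linarith

end Summit.KontsevichZagierPeriods.SymplecticScissors.RealOnePeriodRelations.MultiEllLayer

end
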